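import Mathlib
import HarnessLib
import Literature.Computability.AlgebraicComplexity.DiPatternExpressions
import Summits.ValiantsHypothesis.ValiantsHypothesis.Theorems.MonotoneRestorationOrbitRestorationLinearVolumeQPSubThresholdDescentTools
import Summits.ValiantsHypothesis.ValiantsHypothesis.Theorems.MonotoneRestorationOrbitRestorationLinearVolumeQPDiUnfoldingOperations

/-!
# Route MonotoneRestoration — aside `OrbitRestorationLinearVolumeQP` (stmt-ValiantsHypothesis-18294):
# ONE-SORTED `k`-LABEL UNFOLDING, part 3/3 — the closed polynomial of a one-sorted `k`-label expression lies in
# the span of the one-sorted homomorphism polynomials of patterns of treewidth `≤ k - 1`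

Companion of `…DiUnfoldingCertificate.lean` / `…DiUnfoldingOperations.lean`.  A CERTIFIED LABELLED PATTERN is an
edge multiset `E` on `Fin k ⊕ Fin m` with a certificate `N` (six conditions, spelled out verbatim); its LABELLED
VALUE at a label assignment `ℓ : Fin k → Fin n` is `Σ_{g : Fin m → Fin n} Π_{(u,v) ∈ E} x_{(ℓ ⊔ g) u, (ℓ ⊔ g) v}`
(`ℓ ⊔ g = Sum.elim ℓ g`).

* `labelledValue_glue`, `labelledValue_forget`, `labelledValue_close` — gluing multiplies labelled values,
  forgetting label `a` is `Σ_v (·)(ℓ[a := v])`, and `Σ_ℓ` of a labelled value is `dihom_{E,n}`;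
* `value_mem_span` — **the labelled unfolding**: `ℓ ↦ value n e ℓ` lies in the `ℂ`-span, inside the algebra of
  functions `(Fin k → Fin n) → ℂ[x]`, of the labelled values of certified patterns (induction on `e`: the span is
  closed under products by `Submodule.span_mul_span` + gluing, and under the substitution operators
  `F ↦ Σ_v F(·[a := v])` by forgetting);
* `close_mem_span_diHomPoly` — **ONE-SORTED `k`-LABEL UNFOLDING**: `close n e ∈ span_ℂ {dihom_{D,n} : tw D ≤ k - 1}`
  for every `e : DiPatternExpr ℂ k` and every `n` (close the labelled unfolding, bound the treewidth by the
  certificate, transport to `Fin (k + m)`); `close_mem_diNarrowSpan` — the same at any width `w ≥ k - 1`, the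
  hypothesis currency of `SubThresholdDescent.subThreshold_descent`.

With `subThreshold_descent` (p827466) this closes census item (b)/(iii) of the item's evidence memos: the
expression currency of the crux (`…DiNarrowTight`) now feeds the span currency of the registered stub below the
injective threshold (`…HalfDegreeTight.lean`).  Def-free helper (`--supports stmt-ValiantsHypothesis-18294`);
nothing here is a named fact.  Honest label: folklore (the easy half of Dawar–Pago–Seppelt's "k labels ↔
treewidth k − 1" for the one-sorted algebra); the stub `stub_lvNarrowSpan`, R1 and VP ≠ VNP are NOT moved.

References: Dawar–Pago–Seppelt 2025 (arXiv:2502.06740) Thm 1.1, §5, §7 p. 45; Dwivedi–Pago–Seppelt 2026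
(arXiv:2601.09343) eq. (1), Outlook Q3; Courcelle–Engelfriet 2012 §2.3.
-/

noncomputable section

open scoped Classical

-- `Summit.ValiantsHypothesis.ValiantsHypothesis.…` is the tree's single-conjunct layout (Sub = Summit).
set_option linter.dupNamespace false

namespace Summit.ValiantsHypothesis.ValiantsHypothesis.Theorems.DiUnfolding

open Literature.Computability.AlgebraicComplexity MvPolynomial
open Literature.Combinatorics.SimpleGraph (treewidth)
open Summit.ValiantsHypothesis.ValiantsHypothesis.Theorems

variable {k m : ℕ} (n : ℕ)

/-! ### Labelled values under gluing, forgetting and closing -/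

/-- **Gluing multiplies labelled values.**  The labelled value
`ℓ ↦ Σ_{g : Fin m → [n]} Π_{(u,v) ∈ E} x_{(ℓ ⊔ g) u, (ℓ ⊔ g) v}` of the glued pattern (inner vertices
`Fin (m₁ + m₂)`, edge multisets re-indexed and added) is the product of the labelled values. [folklore] -/
theorem labelledValue_glue {m₁ m₂ : ℕ} (E₁ : Multiset ((Fin k ⊕ Fin m₁) × (Fin k ⊕ Fin m₁)))
    (E₂ : Multiset ((Fin k ⊕ Fin m₂) × (Fin k ⊕ Fin m₂))) (ℓ : Fin k → Fin n) :
    (∑ g : Fin m₁ → Fin n, (E₁.map fun e =>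
        (X (Sum.elim ℓ g e.1, Sum.elim ℓ g e.2) : MvPolynomial (Fin n × Fin n) ℂ)).prod) *
      (∑ g : Fin m₂ → Fin n, (E₂.map fun e =>
        (X (Sum.elim ℓ g e.1, Sum.elim ℓ g e.2) : MvPolynomial (Fin n × Fin n) ℂ)).prod) =
    ∑ g : Fin (m₁ + m₂) → Fin n,
      ((E₁.map (Prod.map (Sum.map id (Fin.castAdd m₂)) (Sum.map id (Fin.castAdd m₂))) +
          E₂.map (Prod.map (Sum.map id (Fin.natAdd m₁)) (Sum.map id (Fin.natAdd m₁)))).map fun e =>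
        (X (Sum.elim ℓ g e.1, Sum.elim ℓ g e.2) : MvPolynomial (Fin n × Fin n) ℂ)).prod := by
  rw [Finset.sum_mul_sum, ← Fintype.sum_prod_type']
  refine Fintype.sum_equiv (Fin.appendEquiv m₁ m₂) _ _ fun p => ?_
  have h₁ : ∀ x : Fin k ⊕ Fin m₁,
      Sum.elim ℓ (Fin.appendEquiv m₁ m₂ p) (Sum.map id (Fin.castAdd m₂) x) = Sum.elim ℓ p.1 x := by
    rintro (b | j)
    · rfl
    · simp [Fin.append_left]
  have h₂ : ∀ x : Fin k ⊕ Fin m₂,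
      Sum.elim ℓ (Fin.appendEquiv m₁ m₂ p) (Sum.map id (Fin.natAdd m₁) x) = Sum.elim ℓ p.2 x := by
    rintro (b | j)
    · rfl
    · simp [Fin.append_right]
  rw [Multiset.map_add, Multiset.prod_add, Multiset.map_map, Multiset.map_map]
  simp only [Function.comp_def, Prod.map_fst, Prod.map_snd, h₁, h₂]

/-- **Forgetting a label sums labelled values.**  Summing the labelled value over the value of label `a`
is the labelled value of the pattern in which the vertex holding `a` has become the new inner vertex
`Fin.natAdd m 0` and a fresh isolated vertex holds `a`. [folklore] -/
theorem labelledValue_forget (a : Fin k) (E : Multiset ((Fin k ⊕ Fin m) × (Fin k ⊕ Fin m)))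
    (ℓ : Fin k → Fin n) :
    ∑ v : Fin n, ∑ g : Fin m → Fin n, (E.map fun e =>
        (X (Sum.elim (Function.update ℓ a v) g e.1, Sum.elim (Function.update ℓ a v) g e.2) :
          MvPolynomial (Fin n × Fin n) ℂ)).prod =
    ∑ g : Fin (m + 1) → Fin n,
      ((E.map (Prod.map
          (Sum.elim (fun b => if b = a then Sum.inr (Fin.natAdd m 0) else Sum.inl b)
            (fun j => Sum.inr (Fin.castAdd 1 j)))
          (Sum.elim (fun b => if b = a then Sum.inr (Fin.natAdd m 0) else Sum.inl b)
            (fun j => Sum.inr (Fin.castAdd 1 j))))).map fun e =>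
        (X (Sum.elim ℓ g e.1, Sum.elim ℓ g e.2) : MvPolynomial (Fin n × Fin n) ℂ)).prod := by
  rw [Finset.sum_comm, ← Fintype.sum_equiv (Fin.appendEquiv m 1) _ _ (fun p => rfl),
    Fintype.sum_prod_type]
  refine Finset.sum_congr rfl fun g _ => ?_
  refine Fintype.sum_equiv (Equiv.funUnique (Fin 1) (Fin n)).symm _ _ fun v => ?_
  have h : ∀ x : Fin k ⊕ Fin m,
      Sum.elim ℓ (Fin.appendEquiv m 1 (g, (Equiv.funUnique (Fin 1) (Fin n)).symm v))
        (Sum.elim (fun b => if b = a then Sum.inr (Fin.natAdd m 0) else Sum.inl b)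
          (fun j => Sum.inr (Fin.castAdd 1 j)) x) = Sum.elim (Function.update ℓ a v) g x := by
    rintro (b | j)
    · by_cases hb : b = a
      · subst hb
        simp [Fin.append_right]
      · simp [hb]
    · simp [Fin.append_left]
  rw [Multiset.map_map]
  simp only [Function.comp_def, Prod.map_fst, Prod.map_snd, h]

/-- **Closing a labelled value gives the one-sorted homomorphism polynomial**: summing the labelled
value over all label assignments is `dihom_{E,n}` of the pattern on `Fin k ⊕ Fin m`. [folklore] -/
theorem labelledValue_close (E : Multiset ((Fin k ⊕ Fin m) × (Fin k ⊕ Fin m))) :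
    ∑ ℓ : Fin k → Fin n, ∑ g : Fin m → Fin n, (E.map fun e =>
        (X (Sum.elim ℓ g e.1, Sum.elim ℓ g e.2) : MvPolynomial (Fin n × Fin n) ℂ)).prod =
      diHomPoly E n ℂ := by
  unfold diHomPoly
  rw [← Fintype.sum_prod_type']
  exact Fintype.sum_equiv (Equiv.sumArrowEquivProdArrow (Fin k) (Fin m) (Fin n)).symm _ _ fun p => rfl

/-! ### Unfolding: the labelled value of an expression is a combination of certified labelled patterns -/

/-- **UNFOLDING A ONE-SORTED `k`-LABEL EXPRESSION (labelled form).**  The value `ℓ ↦ value n e ℓ` of a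
one-sorted labelled pattern expression with `k` labels is a `ℂ`-combination, uniform in the label
assignment `ℓ`, of labelled values of CERTIFIED labelled patterns (vertices `Fin k ⊕ Fin m`, together
with an elimination-ordering certificate `N` of width `k - 1`, `…DiUnfoldingCertificate`): induction on
the expression — an edge and a constant are patterns without inner vertices, sums are sums, products GLUE
(`certificate_glue`, `labelledValue_glue`: the span is closed under products), summing out a label
FORGETS it (`certificate_forget`, `labelledValue_forget`: a linear substitution operator preserving the
generators). [folklore] -/
theorem value_mem_span (e : DiPatternExpr ℂ k) :
    (fun ℓ : Fin k → Fin n => e.value n ℓ) ∈ Submodule.span ℂ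
      {F : (Fin k → Fin n) → MvPolynomial (Fin n × Fin n) ℂ |
        ∃ (m : ℕ) (E : Multiset ((Fin k ⊕ Fin m) × (Fin k ⊕ Fin m)))
          (N : Fin m → Finset (Fin k ⊕ Fin m)),
          ((∀ j, (N j).card ≤ k - 1) ∧ (∀ j j', Sum.inr j' ∈ N j → j < j') ∧
            (∀ (j : Fin m) (b : Fin k),
              ((Sum.inr j, Sum.inl b) ∈ E ∨ (Sum.inl b, Sum.inr j) ∈ E) → Sum.inl b ∈ N j) ∧
            (∀ j j' : Fin m,
              ((Sum.inr j, Sum.inr j') ∈ E ∨ (Sum.inr j', Sum.inr j) ∈ E) → j < j' → Sum.inr j' ∈ N j) ∧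
            (∀ j j₁ j₂ : Fin m, Sum.inr j₁ ∈ N j → Sum.inr j₂ ∈ N j → j₁ < j₂ → Sum.inr j₂ ∈ N j₁) ∧
            (∀ (j j₁ : Fin m) (b : Fin k), Sum.inr j₁ ∈ N j → Sum.inl b ∈ N j → Sum.inl b ∈ N j₁)) ∧
          F = fun ℓ => ∑ g : Fin m → Fin n, (E.map fun e =>
            (X (Sum.elim ℓ g e.1, Sum.elim ℓ g e.2) : MvPolynomial (Fin n × Fin n) ℂ)).prod} := by
  set S : Set ((Fin k → Fin n) → MvPolynomial (Fin n × Fin n) ℂ) :=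
    {F : (Fin k → Fin n) → MvPolynomial (Fin n × Fin n) ℂ |
        ∃ (m : ℕ) (E : Multiset ((Fin k ⊕ Fin m) × (Fin k ⊕ Fin m)))
          (N : Fin m → Finset (Fin k ⊕ Fin m)),
          ((∀ j, (N j).card ≤ k - 1) ∧ (∀ j j', Sum.inr j' ∈ N j → j < j') ∧
            (∀ (j : Fin m) (b : Fin k),
              ((Sum.inr j, Sum.inl b) ∈ E ∨ (Sum.inl b, Sum.inr j) ∈ E) → Sum.inl b ∈ N j) ∧
            (∀ j j' : Fin m,
              ((Sum.inr j, Sum.inr j') ∈ E ∨ (Sum.inr j', Sum.inr j) ∈ E) → j < j' → Sum.inr j' ∈ N j) ∧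
            (∀ j j₁ j₂ : Fin m, Sum.inr j₁ ∈ N j → Sum.inr j₂ ∈ N j → j₁ < j₂ → Sum.inr j₂ ∈ N j₁) ∧
            (∀ (j j₁ : Fin m) (b : Fin k), Sum.inr j₁ ∈ N j → Sum.inl b ∈ N j → Sum.inl b ∈ N j₁)) ∧
          F = fun ℓ => ∑ g : Fin m → Fin n, (E.map fun e =>
            (X (Sum.elim ℓ g e.1, Sum.elim ℓ g e.2) : MvPolynomial (Fin n × Fin n) ℂ)).prod} with hS
  -- patterns without inner vertices are certified for free
  have triv : ∀ E : Multiset ((Fin k ⊕ Fin 0) × (Fin k ⊕ Fin 0)),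
      (fun ℓ : Fin k → Fin n => ∑ g : Fin 0 → Fin n, (E.map fun e =>
        (X (Sum.elim ℓ g e.1, Sum.elim ℓ g e.2) : MvPolynomial (Fin n × Fin n) ℂ)).prod) ∈ S := fun E =>
    ⟨0, E, fun j => j.elim0, ⟨fun j => j.elim0, fun j => j.elim0, fun j => j.elim0, fun j => j.elim0,
      fun j => j.elim0, fun j => j.elim0⟩, rfl⟩
  induction e with
  | edge a b =>
    refine Submodule.subset_span ((congrArg (· ∈ S) ?_).mpr (triv {(Sum.inl a, Sum.inl b)}))
    funext ℓ
    simp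
  | const c =>
    have h : (fun ℓ : Fin k → Fin n => (DiPatternExpr.const c : DiPatternExpr ℂ k).value n ℓ) =
        c • fun ℓ : Fin k → Fin n => ∑ g : Fin 0 → Fin n,
          ((0 : Multiset ((Fin k ⊕ Fin 0) × (Fin k ⊕ Fin 0))).map fun e =>
            (X (Sum.elim ℓ g e.1, Sum.elim ℓ g e.2) : MvPolynomial (Fin n × Fin n) ℂ)).prod := by
      funext ℓ
      simp [MvPolynomial.C_eq_smul_one]
    rw [h]
    exact Submodule.smul_mem _ c (Submodule.subset_span (triv 0))
  | add e₁ e₂ ih₁ ih₂ =>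
    have h : (fun ℓ : Fin k → Fin n => (e₁.add e₂).value n ℓ) =
        (fun ℓ => e₁.value n ℓ) + fun ℓ => e₂.value n ℓ := by
      funext ℓ
      rfl
    rw [h]
    exact Submodule.add_mem _ ih₁ ih₂
  | mul e₁ e₂ ih₁ ih₂ =>
    have hmul : ∀ F ∈ S, ∀ G ∈ S, F * G ∈ S := by
      rintro _ ⟨m₁, E₁, N₁, ⟨a1, a2, a3, a4, a5, a6⟩, rfl⟩ _ ⟨m₂, E₂, N₂, ⟨b1, b2, b3, b4, b5, b6⟩, rfl⟩
      refine ⟨m₁ + m₂, _, _, certificate_glue E₁ N₁ E₂ N₂ a1 a2 a3 a4 a5 a6 b1 b2 b3 b4 b5 b6 _ rfl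
        _ rfl, ?_⟩
      funext ℓ
      exact labelledValue_glue n E₁ E₂ ℓ
    have h : (fun ℓ : Fin k → Fin n => (e₁.mul e₂).value n ℓ) =
        (fun ℓ => e₁.value n ℓ) * fun ℓ => e₂.value n ℓ := by
      funext ℓ
      rfl
    rw [h]
    have hle : Submodule.span ℂ S * Submodule.span ℂ S ≤ Submodule.span ℂ S := by
      rw [Submodule.span_mul_span]
      refine Submodule.span_le.2 ?_
      rintro _ ⟨F, hF, G, hG, rfl⟩
      exact Submodule.subset_span (hmul F hF G hG)
    exact hle (Submodule.mul_mem_mul ih₁ ih₂)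
  | sumLabel a e ih =>
    let T : ((Fin k → Fin n) → MvPolynomial (Fin n × Fin n) ℂ) →ₗ[ℂ]
        ((Fin k → Fin n) → MvPolynomial (Fin n × Fin n) ℂ) :=
      ∑ v : Fin n, LinearMap.funLeft ℂ (MvPolynomial (Fin n × Fin n) ℂ)
        (fun ℓ : Fin k → Fin n => Function.update ℓ a v)
    have hT : ∀ F ℓ, T F ℓ = ∑ v, F (Function.update ℓ a v) := by
      intro F ℓ
      simp only [T, LinearMap.coe_sum, Finset.sum_apply, LinearMap.funLeft_apply]
    have hmap : ∀ F ∈ S, T F ∈ S := by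
      rintro _ ⟨m, E, N, ⟨a1, a2, a3, a4, a5, a6⟩, rfl⟩
      refine ⟨m + 1, _, _, certificate_forget a E N a1 a2 a3 a4 a5 a6 _ rfl _ rfl, ?_⟩
      funext ℓ
      rw [hT]
      exact labelledValue_forget n a E ℓ
    have h : (fun ℓ : Fin k → Fin n => (e.sumLabel a).value n ℓ) = T fun ℓ => e.value n ℓ := by
      funext ℓ
      rw [hT]
      rfl
    rw [h]
    have hle : Submodule.map T (Submodule.span ℂ S) ≤ Submodule.span ℂ S :=
      (Submodule.map_span_le _ _ _).2 fun F hF => Submodule.subset_span (hmap F hF)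
    exact hle (Submodule.mem_map_of_mem ih)

/-! ### The closed polynomial -/

/-- **ONE-SORTED `k`-LABEL UNFOLDING.**  The closed polynomial `close n e = Σ_ℓ value n e ℓ` of every
one-sorted labelled pattern expression `e` over `ℂ` with `k` labels (Dawar–Pago–Seppelt's algebra of directed
looped patterns with labelled vertices: edges `x_{ℓ a, ℓ b}`, constants, sums, gluing products, summing out a
label — `DiPatternExpressions.lean`), of ANY length, lies in the `ℂ`-span of the one-sorted homomorphism
polynomials `dihom_{D,n}` of directed looped multigraph patterns `D` of TREEWIDTH `≤ k - 1`.  (Closing the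
labelled unfolding `value_mem_span`: `Σ_ℓ` of a labelled value is `dihom` of the pattern,
`labelledValue_close`; its certificate bounds the treewidth, `treewidth_le_of_certificate`; transport to
`Fin (k + m)`.)  This is the expression → span half of "k labels = treewidth k − 1" for the one-sorted
graph algebra, the converse currency change to K2 `HomPolyClose`. [folklore] -/
theorem close_mem_span_diHomPoly (k n : ℕ) (e : DiPatternExpr ℂ k) :
    e.close n ∈ Submodule.span ℂ {q : MvPolynomial (Fin n × Fin n) ℂ |
      ∃ (a : ℕ) (D : Multiset (Fin a × Fin a)),
        treewidth (SimpleGraph.fromRel fun u v : Fin a => ∃ e ∈ D, u = e.1 ∧ v = e.2) ≤ k - 1 ∧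
          q = diHomPoly D n ℂ} := by
  let Φ : ((Fin k → Fin n) → MvPolynomial (Fin n × Fin n) ℂ) →ₗ[ℂ] MvPolynomial (Fin n × Fin n) ℂ :=
    ∑ ℓ : Fin k → Fin n, LinearMap.proj ℓ
  have hΦ : ∀ F, Φ F = ∑ ℓ, F ℓ := by
    intro F
    simp only [Φ, LinearMap.coe_sum, Finset.sum_apply, LinearMap.proj_apply]
  have hclose : e.close n = Φ fun ℓ => e.value n ℓ := by
    rw [hΦ]
    rfl
  rw [hclose]
  refine ((Submodule.map_span_le _ _ _).2 ?_) (Submodule.mem_map_of_mem (value_mem_span n e))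
  rintro _ ⟨m, E, N, ⟨a1, a2, a3, a4, a5, a6⟩, rfl⟩
  refine Submodule.subset_span ⟨k + m, E.map fun e => (finSumFinEquiv e.1, finSumFinEquiv e.2), ?_, ?_⟩
  · rw [SubThresholdDescent.treewidth_map_equiv E finSumFinEquiv]
    exact treewidth_le_of_certificate E N a1 a2 a3 a4 a5 a6
  · rw [hΦ, SubThresholdDescent.diHomPoly_map_equiv E finSumFinEquiv n]
    exact labelledValue_close n E

/-- **ONE-SORTED `k`-LABEL UNFOLDING, width form**: for `k ≤ w + 1`, the closed polynomial of a one-sorted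
`k`-label expression lies in the one-sorted narrow span of width `w` (the hypothesis currency of
`SubThresholdDescent.subThreshold_descent`). [folklore] -/
theorem close_mem_diNarrowSpan (k n w : ℕ) (hk : k ≤ w + 1) (e : DiPatternExpr ℂ k) :
    e.close n ∈ Submodule.span ℂ {q : MvPolynomial (Fin n × Fin n) ℂ |
      ∃ (a : ℕ) (D : Multiset (Fin a × Fin a)),
        treewidth (SimpleGraph.fromRel fun u v : Fin a => ∃ e ∈ D, u = e.1 ∧ v = e.2) ≤ w ∧
          q = diHomPoly D n ℂ} := by
  refine Submodule.span_mono (fun q hq => ?_) (close_mem_span_diHomPoly k n e)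
  obtain ⟨a, D, hD, rfl⟩ := hq
  exact ⟨a, D, hD.trans (by omega), rfl⟩

end Summit.ValiantsHypothesis.ValiantsHypothesis.Theorems.DiUnfolding

end
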